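import Literature.Algebra.Homology.ExtDualityLadder
import Mathlib.Algebra.Homology.DerivedCategory.Ext.Map
import Mathlib.Algebra.FiveLemma
import HarnessLib

/-!
# Local–global maps on `Ext` along a family of exact functors, and their four-lemma dévissage
# (the formal skeleton of Milne ADT I Lemma 4.13 / Harari Prop. 17.25 for a FINITE module, from the
# permutation-module case)

Topic `Algebra/Homology`; namespace `Literature.Algebra.Homology.ExtLocalization`.  Pure homological
algebra for Mathlib's `Abelian.Ext` (derived-category `Ext` in abelian categories with `HasExt`); two
definitions with bodies (`piMap`, `locMap`) and theorems; no named fact, no instance, no notation, no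
`sorry`.  Sequel in spirit of door-c4's `ExtDualityLadder` (whose row-exactness lemmas
`ExtDuality.exact_precomp_*` — Mathlib's contravariant long exact `Ext(–, B)`-sequence as
`Function.Exact` — are reused here) with the DUAL of a class formation replaced by a family of exact
"localisation" functors.

THE SITUATION.  `C` an abelian category, `B : C` a fixed coefficient object, `(D i)_{i ∈ ι}` abelian
categories, `L i : C ⥤ D i` EXACT additive functors, `Y i : D i` and morphisms `q i : (L i) B ⟶ Y i`.
The LOCALISATION MAP in degree `n` at the object `A` is

  `locMap A n : Extⁿ_C(A, B) →+ ∏ᵢ Extⁿ_{D i}((L i) A, Y i)`,  `x ↦ (q i ∘ (L i) x)ᵢ`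

(Mathlib `Ext.mapExactFunctor` followed by post-composition with `q i`).  It is natural in `A`
(`locMap_comp_precomp_mk₀`) and commutes with the connecting homomorphisms of the contravariant long
exact sequences of a short exact `S : 0 → X₁ → X₂ → X₃ → 0` in `C` and of its (short exact) images
`S.map (L i)` (`locMap_comp_precomp_extClass`; Mathlib `Ext.mapExactFunctor_comp/_extClass`).  Hence the
two FOUR-LEMMA TRANSFERS along the ladder

  `Extʳ(X₂, B) → Extʳ(X₁, B) →δ Extʳ⁺¹(X₃, B) → Extʳ⁺¹(X₂, B)`       (rows exact, products of exact rows exact)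

* `locMap_injective_of_shortExact`: `loc(X₃, r+1)` injective ⟸ `loc(X₂, r)` onto, `loc(X₁, r)`
  injective, `loc(X₂, r+1)` injective;
* `locMap_surjective_of_shortExact`: `loc(X₁, r)` onto ⟸ `loc(X₂, r)` onto, `loc(X₃, r+1)` onto,
  `loc(X₂, r+1)` injective;

and the TWO-STEP DÉVISSAGE `locMap_injective_of_twoStep`: for a presentation
`P₁ → P₀ → A → 0` cut into `S : 0 → N₁ → P₀ → A → 0` and `S' : 0 → N₂ → P₁ → N₁ → 0`,
`loc(A, n+2)` is injective as soon as `loc(P₁, n)` is onto, `loc(N₂, n)` and `loc(P₁, n+1)` are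
injective, `loc(P₀, n+1)` is onto and `loc(P₀, n+2)` is injective.

WHY (the arithmetic it is written for; nothing of it is proved here).  Milne, *Arithmetic Duality
Theorems* I, Lemma 4.13 and the proof of Thm. 4.10 (a) (p. 58); Harari, *Galois Cohomology and Class
Field Theory*, §17.5, Prop. 17.25: for the `S`-restricted `Ш`-pairing on the `Ext` road one needs, for
a finite `G_S`-module `A`, that `Ext²_{G_S}(A, I_S) → ∏_{v ∈ S} Ext²_{Γ_{K_v}}(A, K̄_vˣ) = ∏ H²(K_v, ·)`
is INJECTIVE (hypothesis (Λ2) of bsd-eis -w7 g12's `PoitouTateRestrictedShaTwoLocalCriterion`).  With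
`C = C_{G_S}`, `D v = C_{Γ_{K_v}}`, `L v` the pull-back along `Γ_{K_v} → G_S`, `B = Ī_S`, `Y v = K̄_vˣ`,
`q v` the idèle projection, and a presentation of `A` by permutation modules `ℤ[G_S/U]^m` (`U` open
normal acting trivially on `A`), the five hypotheses of `locMap_injective_of_twoStep` are statements
about `Hom`, `H¹` and `H²` of the open subgroup `U` with values in `I_S` (Hilbert 90, Shapiro's lemma
at a finite layer, injectivity of inflation on Brauer groups) — the "permutation-level" inputs; the
present file is the formal reduction to them.  HONEST FRAMING: homological algebra only; no
arithmetic statement, no case of Poitou–Tate duality and nothing about BSD is proved here.  Written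
for the background lane «PT-Ш-S-TC» of crux `stmt-BirchSwinnertonDyer-19032` (cell bsd-eis, seat
bsd-line-x1-p1-w4 gen 20), brick (Λ)(e).  AI formalisation, established only by the kernel check.

## References
* J. S. Milne, *Arithmetic Duality Theorems*, 2nd ed. (2006), I §0 (the `Ext` sequences, (0.8)),
  I Lemma 4.13, I Thm. 4.10 (a) (proof, p. 58). [MilneADT2006]
* D. Harari, *Galois Cohomology and Class Field Theory*, Universitext (2020), §16.2 Prop. 16.16,
  §17.5 Lemma 17.23, Prop. 17.25 (pp. 298–301). [Harari2020]
* S. Mac Lane, *Homology*, Grundlehren 114 (1963), I Lemma 3.3 (the four lemma). [MacLane1963Homology]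
-/

noncomputable section

universe w w' v v' u u' t t₁ t₂ t₃

namespace Literature.Algebra.Homology

namespace ExtLocalization

open CategoryTheory CategoryTheory.Limits CategoryTheory.Abelian

/-! ## §0 Componentwise maps of products of abelian groups -/

section Pi

variable {ι : Type t} {M : ι → Type t₁} {N : ι → Type t₂} {P : ι → Type t₃}
  [∀ i, AddCommGroup (M i)] [∀ i, AddCommGroup (N i)] [∀ i, AddCommGroup (P i)]

/-- The componentwise map `∏ᵢ Mᵢ →+ ∏ᵢ Nᵢ` of a family of additive maps `φ i : M i →+ N i`.
[cite: MacLane1963Homology, I §3] -/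
def piMap (φ : ∀ i, M i →+ N i) : (∀ i, M i) →+ ∀ i, N i :=
  AddMonoidHom.pi fun i => (φ i).comp (Pi.evalAddMonoidHom M i)

/-- Formula: `piMap φ x i = φ i (x i)`. [cite: MacLane1963Homology, I §3] -/
@[simp] theorem piMap_apply (φ : ∀ i, M i →+ N i) (x : ∀ i, M i) (i : ι) :
    piMap φ x i = φ i (x i) := rfl

/-- **A product of exact pairs is exact**: if `M i → N i → P i` is exact for every `i`, so is
`∏ M i → ∏ N i → ∏ P i` (axiom of choice for the preimages). [cite: MacLane1963Homology, I §3] -/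
theorem exact_piMap {φ : ∀ i, M i →+ N i} {ψ : ∀ i, N i →+ P i}
    (h : ∀ i, Function.Exact (φ i) (ψ i)) : Function.Exact (piMap φ) (piMap ψ) := by
  intro y
  constructor
  · intro hy
    have hy' : ∀ i, ∃ x : M i, φ i x = y i := fun i => ((h i) (y i)).1 (congr_fun hy i)
    choose x hx using hy'
    exact ⟨x, funext hx⟩
  · rintro ⟨x, rfl⟩
    funext i
    exact ((h i) (φ i (x i))).2 ⟨x i, rfl⟩

/-- Injectivity is componentwise. [cite: MacLane1963Homology, I §3] -/
theorem piMap_injective {φ : ∀ i, M i →+ N i} (h : ∀ i, Function.Injective (φ i)) :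
    Function.Injective (piMap φ) :=
  fun _ _ hxy => funext fun i => h i (congr_fun hxy i)

/-- Surjectivity is componentwise (choice). [cite: MacLane1963Homology, I §3] -/
theorem piMap_surjective {φ : ∀ i, M i →+ N i} (h : ∀ i, Function.Surjective (φ i)) :
    Function.Surjective (piMap φ) := fun y => by
  choose x hx using fun i => h i (y i)
  exact ⟨x, funext hx⟩

end Pi

/-! ## §1 The localisation map and its naturality -/

section Loc

variable {C : Type u} [Category.{v} C] [Abelian C] [HasExt.{w} C]
  {ι : Type t} {D : ι → Type u'} [∀ i, Category.{v'} (D i)] [∀ i, Abelian (D i)]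
  [∀ i, HasExt.{w'} (D i)]
  (L : ∀ i, C ⥤ D i) [∀ i, (L i).Additive] [∀ i, PreservesFiniteLimits (L i)]
  [∀ i, PreservesFiniteColimits (L i)]
  {B : C} {Y : ∀ i, D i} (q : ∀ i, (L i).obj B ⟶ Y i)

/-- **The localisation map** `Extⁿ_C(A, B) →+ ∏ᵢ Extⁿ_{D i}((L i) A, Y i)`, `x ↦ (q i ∘ (L i) x)ᵢ`:
apply the exact functor `L i` (Mathlib `Functor.mapExtAddHom`) and post-compose with `q i`.
In the arithmetic application: `Extⁿ_{G_S}(A, I_S) → ∏_{v ∈ S} Extⁿ_{Γ_{K_v}}(A, K̄_vˣ)`, pull back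
to the decomposition groups and project the idèles. [cite: Harari2020, §17.5 Prop. 17.25]
[cite: MilneADT2006, I Lemma 4.13] -/
def locMap (A : C) (n : ℕ) : Ext A B n →+ ∀ i, Ext ((L i).obj A) (Y i) n :=
  AddMonoidHom.pi fun i =>
    ((Ext.mk₀ (q i)).postcomp ((L i).obj A) (add_zero n)).comp ((L i).mapExtAddHom A B n)

/-- Formula: `locMap A n x i = ((L i) x) ∘ q i`. [cite: Harari2020, §17.5 Prop. 17.25] -/
theorem locMap_apply (A : C) (n : ℕ) (x : Ext A B n) (i : ι) :
    locMap L q A n x i = (x.mapExactFunctor (L i)).comp (Ext.mk₀ (q i)) (add_zero n) := rfl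

/-- Degree `0`: on the class of a morphism `f : A ⟶ B`, `locMap A 0 [f] i = [(L i) f ≫ q i]`.
[cite: Harari2020, §17.5 Prop. 17.25] -/
theorem locMap_mk₀ {A : C} (f : A ⟶ B) (i : ι) :
    locMap L q A 0 (Ext.mk₀ f) i = Ext.mk₀ ((L i).map f ≫ q i) := by
  rw [locMap_apply, Ext.mapExactFunctor_mk₀, Ext.mk₀_comp_mk₀]

/-- **Naturality in `A`** (the squares of the ladder with a morphism): for `g : A' ⟶ A`,
`(∏ᵢ ((L i) g)^*) ∘ locMap A = locMap A' ∘ g^*` on `Extⁿ(A, B)`.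
[cite: Harari2020, §16.2 Prop. 16.16][cite: MilneADT2006, I §0] -/
theorem locMap_comp_precomp_mk₀ {A A' : C} (g : A' ⟶ A) (n : ℕ) :
    (piMap fun i => (Ext.mk₀ ((L i).map g)).precomp (Y i) (zero_add n)).comp (locMap L q A n) =
      (locMap L q A' n).comp ((Ext.mk₀ g).precomp B (zero_add n)) := by
  ext x i
  change (Ext.mk₀ ((L i).map g)).comp ((x.mapExactFunctor (L i)).comp (Ext.mk₀ (q i)) (add_zero n))
      (zero_add n) =
    (((Ext.mk₀ g).comp x (zero_add n)).mapExactFunctor (L i)).comp (Ext.mk₀ (q i)) (add_zero n)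
  rw [Ext.mapExactFunctor_comp, Ext.mapExactFunctor_mk₀, Ext.comp_assoc_of_third_deg_zero]

/-- **Compatibility with connecting homomorphisms** (the square of the ladder with `δ`): for a short
exact `S : 0 → X₁ → X₂ → X₃ → 0` in `C` (so that each `S.map (L i)` is short exact) and
`1 + n₀ = n₁`, `(∏ᵢ δ_{S.map (L i)}) ∘ locMap X₁ = locMap X₃ ∘ δ_S` on `Ext^{n₀}(X₁, B)`, where `δ` is
pre-composition with the extension class (Mathlib `Ext.mapExactFunctor_extClass`).
[cite: Harari2020, §16.2 Prop. 16.16][cite: MilneADT2006, I §0] -/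
theorem locMap_comp_precomp_extClass {S : ShortComplex C} (hS : S.ShortExact) {n₀ n₁ : ℕ}
    (h : 1 + n₀ = n₁) :
    (piMap fun i => (hS.map_of_exact (L i)).extClass.precomp (Y i) h).comp (locMap L q S.X₁ n₀) =
      (locMap L q S.X₃ n₁).comp (hS.extClass.precomp B h) := by
  ext x i
  change (hS.map_of_exact (L i)).extClass.comp
      ((x.mapExactFunctor (L i)).comp (Ext.mk₀ (q i)) (add_zero n₀)) h =
    ((hS.extClass.comp x h).mapExactFunctor (L i)).comp (Ext.mk₀ (q i)) (add_zero n₁)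
  rw [Ext.mapExactFunctor_comp, Ext.mapExactFunctor_extClass, Ext.comp_assoc_of_third_deg_zero]
  rfl

/-! ## §2 The four-lemma transfers along `0 → X₁ → X₂ → X₃ → 0` -/

/-- **Injectivity transfer.**  For `S : 0 → X₁ → X₂ → X₃ → 0` short exact in `C` and `1 + r = r'`:
if `locMap X₂ r` is onto, `locMap X₁ r` is injective and `locMap X₂ r'` is injective, then
`locMap X₃ r'` is injective — the four lemma on the ladder
`Extʳ(X₂, B) → Extʳ(X₁, B) →δ Extʳ'(X₃, B) → Extʳ'(X₂, B)` over the product of the ladders of the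
`S.map (L i)` (rows exact: Mathlib's contravariant `Ext` sequence; a product of exact rows is exact).
[cite: MilneADT2006, I Lemma 4.13][cite: Harari2020, §17.5 Prop. 17.25][cite: MacLane1963Homology, I Lemma 3.3] -/
theorem locMap_injective_of_shortExact {S : ShortComplex C} (hS : S.ShortExact) {r r' : ℕ}
    (hr : 1 + r = r') (h₂ : Function.Surjective (locMap L q S.X₂ r))
    (h₁ : Function.Injective (locMap L q S.X₁ r)) (h₂' : Function.Injective (locMap L q S.X₂ r')) :
    Function.Injective (locMap L q S.X₃ r') :=
  AddMonoidHom.injective_of_surjective_of_injective_of_injective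
    ((Ext.mk₀ S.f).precomp B (zero_add r)) (hS.extClass.precomp B hr)
    ((Ext.mk₀ S.g).precomp B (zero_add r'))
    (piMap fun i => (Ext.mk₀ ((L i).map S.f)).precomp (Y i) (zero_add r))
    (piMap fun i => (hS.map_of_exact (L i)).extClass.precomp (Y i) hr)
    (piMap fun i => (Ext.mk₀ ((L i).map S.g)).precomp (Y i) (zero_add r'))
    (locMap L q S.X₂ r) (locMap L q S.X₁ r) (locMap L q S.X₃ r') (locMap L q S.X₂ r')
    (locMap_comp_precomp_mk₀ L q S.f r) (locMap_comp_precomp_extClass L q hS hr)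
    (locMap_comp_precomp_mk₀ L q S.g r')
    (ExtDuality.exact_precomp_f_extClass hS B hr) (ExtDuality.exact_precomp_extClass_g hS B hr)
    (exact_piMap fun i => ExtDuality.exact_precomp_f_extClass (hS.map_of_exact (L i)) (Y i) hr)
    h₂ h₁ h₂'

/-- **Surjectivity transfer.**  For `S : 0 → X₁ → X₂ → X₃ → 0` short exact in `C` and `1 + r = r'`:
if `locMap X₂ r` is onto, `locMap X₃ r'` is onto and `locMap X₂ r'` is injective, then `locMap X₁ r`
is onto — the other four lemma on `Extʳ(X₂, B) → Extʳ(X₁, B) →δ Extʳ'(X₃, B) → Extʳ'(X₂, B)`.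
[cite: MilneADT2006, I Lemma 4.13][cite: Harari2020, §17.5 Prop. 17.25][cite: MacLane1963Homology, I Lemma 3.3] -/
theorem locMap_surjective_of_shortExact {S : ShortComplex C} (hS : S.ShortExact) {r r' : ℕ}
    (hr : 1 + r = r') (h₂ : Function.Surjective (locMap L q S.X₂ r))
    (h₃' : Function.Surjective (locMap L q S.X₃ r'))
    (h₂' : Function.Injective (locMap L q S.X₂ r')) :
    Function.Surjective (locMap L q S.X₁ r) :=
  AddMonoidHom.surjective_of_surjective_of_surjective_of_injective
    ((Ext.mk₀ S.f).precomp B (zero_add r)) (hS.extClass.precomp B hr)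
    ((Ext.mk₀ S.g).precomp B (zero_add r'))
    (piMap fun i => (Ext.mk₀ ((L i).map S.f)).precomp (Y i) (zero_add r))
    (piMap fun i => (hS.map_of_exact (L i)).extClass.precomp (Y i) hr)
    (piMap fun i => (Ext.mk₀ ((L i).map S.g)).precomp (Y i) (zero_add r'))
    (locMap L q S.X₂ r) (locMap L q S.X₁ r) (locMap L q S.X₃ r') (locMap L q S.X₂ r')
    (locMap_comp_precomp_mk₀ L q S.f r) (locMap_comp_precomp_extClass L q hS hr)
    (locMap_comp_precomp_mk₀ L q S.g r')
    (ExtDuality.exact_precomp_extClass_g hS B hr)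
    (exact_piMap fun i => ExtDuality.exact_precomp_f_extClass (hS.map_of_exact (L i)) (Y i) hr)
    (exact_piMap fun i => ExtDuality.exact_precomp_extClass_g (hS.map_of_exact (L i)) (Y i) hr)
    h₂ h₃' h₂'

/-! ## §3 The two-step dévissage along a presentation `P₁ → P₀ → A → 0` -/

/-- **Dévissage (Milne I Lemma 4.13 / Harari Prop. 17.25, formal part).**  Let
`S : 0 → N₁ → P₀ → A → 0` and `0 → N₂ →i₂ P₁ →p₁ N₁ → 0` be short exact in `C` (a two-step
presentation of `A`; in the application `P₀`, `P₁` are permutation modules `ℤ[G_S/U]^m`) and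
`1 + n₀ = n₁`, `1 + n₁ = n₂`.  If `locMap P₁ n₀` is onto, `locMap N₂ n₀` and `locMap P₁ n₁` are
injective, `locMap P₀ n₁` is onto and `locMap P₀ n₂` is injective, then `locMap A n₂` is injective
(two injectivity transfers).  With `n₂ = 2` this is the reduction of hypothesis (Λ2) of the
`S`-restricted `Ш`-pairing to permutation-level statements.
[cite: MilneADT2006, I Lemma 4.13, I Thm. 4.10 (a) (proof, p. 58)][cite: Harari2020, §17.5 Lemma 17.23, Prop. 17.25] -/
theorem locMap_injective_of_twoStep {S : ShortComplex C} (hS : S.ShortExact) {N₂ P₁ : C}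
    {i₂ : N₂ ⟶ P₁} {p₁ : P₁ ⟶ S.X₁} {hw : i₂ ≫ p₁ = 0}
    (hS' : (ShortComplex.mk i₂ p₁ hw).ShortExact) {n₀ n₁ n₂ : ℕ} (h₁ : 1 + n₀ = n₁)
    (h₂ : 1 + n₁ = n₂) (hP₁ : Function.Surjective (locMap L q P₁ n₀))
    (hN₂ : Function.Injective (locMap L q N₂ n₀)) (hP₁' : Function.Injective (locMap L q P₁ n₁))
    (hP₀ : Function.Surjective (locMap L q S.X₂ n₁))
    (hP₀' : Function.Injective (locMap L q S.X₂ n₂)) :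
    Function.Injective (locMap L q S.X₃ n₂) :=
  locMap_injective_of_shortExact L q hS h₂ hP₀
    (locMap_injective_of_shortExact L q hS' h₁ hP₁ hN₂ hP₁') hP₀'

end Loc

end ExtLocalization

end Literature.Algebra.Homology

end
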